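import Literature.NumberTheory.Automorphic.StrongArtinGL2WeightOneAssembly
import Literature.NumberTheory.Automorphic.GL2NewvectorExistence
import HarnessLib

/-!
# Gelbart 1997, Prop. 4.2 from Deligne–Serre Thm. 4.1 and Prop. 4.1 at `∞`

Topic `NumberTheory/Automorphic`; an assembly (theorems only: no definition, no named fact). The
tree's `StrongArtinGL2WeightOneAssembly.exists_isNewform1_of_isPiOfArtinRep_of_pair_of_fixed` proves
the named fact `exists_isNewform1_of_isPiOfArtinRep` (Gelbart 1997, Prop. 4.2: an odd irreducible
`σ : G_ℚ → GL₂(ℂ)` with `π(σ)` cuspidal automorphic comes from a weight-one newform of level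
`cond σ`) from three hypotheses `hDS`, `hpair`, `hfix`. The third — the existence of a non-zero
`K₁(N)`-fixed vector in every cuspidal automorphic `π` of `GL₂(𝔸_ℚ)` (Casselman 1973, Thm. 1,
existence half) — is now the theorem `CuspidalAutomorphicRepData.exists_gammaOneFiniteLevel_fixed`
(`GL2NewvectorExistence`), so Prop. 4.2 holds granted

* `hDS` — Deligne–Serre, Thm. 4.1 (the tree's named fact `exists_complexGaloisRep_of_weight_one`), and
* `hpair` — Gelbart 1997, Prop. 4.1 at the archimedean place: the Harish-Chandra parameter of
  `π(σ)_∞` is a pair `{s, s}` (`π_∞ = π(σ_∞)` with `σ_∞ ≃ 1 ⊕ sgn` for odd `σ`).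

## References

* S. Gelbart, *Three lectures on the modularity of `ρ̄_{E,3}` and the Langlands reciprocity
  conjecture* (1997), Prop. 4.2, Prop. 4.1, Prop. 2.5 [Gelbart1997].
* P. Deligne, J.-P. Serre, *Formes modulaires de poids 1*, ASENS 7 (1974), Thm. 4.1 [DeligneSerreASENS1974].
* W. Casselman, *On some results of Atkin and Lehner*, Math. Ann. 201 (1973), Thm. 1 [Casselman1973].
-/

noncomputable section

open scoped MatrixGroups Classical

namespace Literature.NumberTheory.Automorphic

open EllipticCurves.ModularForms

/-- **Gelbart 1997, Prop. 4.2, granted Deligne–Serre Thm. 4.1 (`hDS`) and its archimedean input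
"`π(σ)` is of weight one for odd irreducible `σ`" (`harch`: `π_∞ = π(1, sgn)`, Gelbart's proof of
Prop. 4.2 with Prop. 4.1 at `∞`).** For `σ : G_ℚ → GL₂(ℂ)` odd and irreducible with `π(σ)` cuspidal
automorphic, there is a weight-one newform `f` of level `cond σ` whose Hecke polynomials at
`p ∤ cond σ` are the Satake polynomials of `π(σ)`. The existence of the new vector (`hfix` of
`exists_isNewform1_of_isPiOfArtinRep_of_isOfWeightOne_of_fixed`) is discharged by
`CuspidalAutomorphicRepData.exists_gammaOneFiniteLevel_fixed`.
[cite: Gelbart1997, Prop. 4.2] [cite: DeligneSerreASENS1974, Thm. 4.1] [cite: Casselman1973, Thm. 1] -/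
theorem exists_isNewform1_of_isPiOfArtinRep_of_isOfWeightOne
    (hDS : ∀ {N : ℕ} [NeZero N], exists_complexGaloisRep_of_weight_one (N := N))
    (harch : ∀ (hcpt : isCompact_glFiniteIntegralLevel 2 ℚ)
      (σ : GaloisRepresentations.FramedArtinRep ℚ 2) (π : CuspidalAutomorphicRepData 2 ℚ hcpt),
      σ.toGaloisRep.IsIrreducible → σ.IsOdd → IsPiOfArtinRep σ π.1 → π.1.IsOfWeightOne) :
    exists_isNewform1_of_isPiOfArtinRep :=
  exists_isNewform1_of_isPiOfArtinRep_of_isOfWeightOne_of_fixed hDS harch fun _ π₀ _ _ _ =>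
    π₀.exists_gammaOneFiniteLevel_fixed

/-- **Gelbart 1997, Prop. 4.2, granted Deligne–Serre Thm. 4.1 (`hDS`) and Prop. 4.1 at `∞` as a
parameter pair (`hpair`: the Harish-Chandra parameter of `π(σ)_∞` is `{s, s}`).**
[cite: Gelbart1997, Prop. 4.2 and Prop. 4.1] [cite: DeligneSerreASENS1974, Thm. 4.1] [cite: Casselman1973, Thm. 1] -/
theorem exists_isNewform1_of_isPiOfArtinRep_of_pair
    (hDS : ∀ {N : ℕ} [NeZero N], exists_complexGaloisRep_of_weight_one (N := N))
    (hpair : ∀ (hcpt : isCompact_glFiniteIntegralLevel 2 ℚ)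
      (σ : GaloisRepresentations.FramedArtinRep ℚ 2) (π : CuspidalAutomorphicRepData 2 ℚ hcpt),
      σ.toGaloisRep.IsIrreducible → σ.IsOdd → IsPiOfArtinRep σ π.1 →
        ∃ s : ℂ, π.1.HasArchParameter fun _ => ({s, s} : Multiset ℂ)) :
    exists_isNewform1_of_isPiOfArtinRep :=
  exists_isNewform1_of_isPiOfArtinRep_of_pair_of_fixed hDS hpair fun _ π₀ _ _ _ =>
    π₀.exists_gammaOneFiniteLevel_fixed

end Literature.NumberTheory.Automorphic

end
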